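import Summits.CriticalPhenomena.CardyFormulaZ2.Theorems.CardyBoundaryCoulombGasHalfPlaneMarkDensityLawSelfDualityBulk

/-!
# Self-duality of the half-plane arc-crossing function of bond-`ℤ²`, part 6b: few touches, the scales

Support file for the crux `HalfPlaneMarkDensityLaw` (stmt-CriticalPhenomena-5661), line `Sketch`
(a-priori structure of the open stub C⁺: self-duality, Stage II — bottom-row insensitivity).
Choice of the MACROSCOPIC scales `s_j = ⌊κ_j n⌋` (`κ₀ = δ/2`, `κ_{j+1} = κ_j · r(κ_j)`) in the
fixed-scale bound of part 6a and the resulting smallness of the bulk few-touches event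
(registered stub `bulk_small_of`, modulo the isolated-block lemma of part 5d): at level `j` there
are only `O(Λ/(M κ_{j+1}))` grid windows, each carrying a three-arm event of probability
`≤ C (8 M K κ_{j+1}/κ_j)^{1+α}` (`Z2HalfPlane.real_threeArm_le`, exponent `1 + α > 1`), so the
level costs `O(κ_{j+1}^α)` and the ratios `r` are chosen small enough level by level
(`level_eventually`).
-/

noncomputable section

namespace Summit.CriticalPhenomena.CardyFormulaZ2.Cruxes.HalfPlaneMarkDensityLaw.SketchLine.SelfDual

open Literature.Probability.Percolation Literature.Probability.LatticeModels
open Literature.Probability.Percolation.Z2HalfPlane (leg adj_leg threeArm)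
open MeasureTheory Filter Set SimpleGraph Topology
open Summit.CriticalPhenomena.CardyFormulaZ2.Theorems.HalfPlaneMarkDensityLaw.Negative

/-! ### Counting grid windows -/

/-- The number of grid windows of size `G` meeting `[z₀, z₁]` is at most `max(z₁ − z₀, 0)/G + 2`.
[folklore] -/
theorem card_Icc_ediv_le {z₀ z₁ G : ℤ} (hG : 0 < G) :
    ((Finset.Icc (z₀ / G) (z₁ / G)).card : ℝ) ≤ max ((z₁ : ℝ) - z₀) 0 / G + 2 := by
  rw [Int.card_Icc]
  have h0 : G * (z₀ / G) ≤ z₀ ∧ z₀ < G * (z₀ / G) + G := by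
    have e1 := Int.mul_ediv_add_emod z₀ G
    have e2 := Int.emod_nonneg z₀ hG.ne'
    have e3 := Int.emod_lt_of_pos z₀ hG
    constructor <;> omega
  have h1 : G * (z₁ / G) ≤ z₁ ∧ z₁ < G * (z₁ / G) + G := by
    have e1 := Int.mul_ediv_add_emod z₁ G
    have e2 := Int.emod_nonneg z₁ hG.ne'
    have e3 := Int.emod_lt_of_pos z₁ hG
    constructor <;> omega
  have hGr : (0 : ℝ) < G := by exact_mod_cast hG
  have h2 : G * (z₁ / G + 1 - z₀ / G) ≤ z₁ - z₀ + 2 * G := by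
    have : G * (z₁ / G + 1 - z₀ / G) = G * (z₁ / G) + G - G * (z₀ / G) := by ring
    omega
  have hmax : (z₁ : ℝ) - z₀ ≤ max ((z₁ : ℝ) - z₀) 0 := le_max_left _ _
  have hmax0 : (0 : ℝ) ≤ max ((z₁ : ℝ) - z₀) 0 := le_max_right _ _
  have key : ((z₁ / G + 1 - z₀ / G : ℤ) : ℝ) ≤ max ((z₁ : ℝ) - z₀) 0 / G + 2 := by
    rw [div_add' _ _ _ hGr.ne', le_div_iff₀ hGr]
    have : ((G * (z₁ / G + 1 - z₀ / G) : ℤ) : ℝ) ≤ ((z₁ - z₀ + 2 * G : ℤ) : ℝ) := by exact_mod_cast h2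
    push_cast at this ⊢
    nlinarith
  rcases le_or_gt (z₁ / G + 1 - z₀ / G) 0 with h | h
  · rw [Int.toNat_of_nonpos h]
    have h3 : (0 : ℝ) ≤ max ((z₁ : ℝ) - z₀) 0 / G + 2 := by positivity
    simpa using h3
  · have : ((z₁ / G + 1 - z₀ / G).toNat : ℝ) = ((z₁ / G + 1 - z₀ / G : ℤ) : ℝ) := by
      exact_mod_cast Int.toNat_of_nonneg h.le
    rw [this]; exact key



/-- Scale separation, first form: `M (s' + 1) + 4 ≤ s` for the floors `s = ⌊κ n⌋`, `s' = ⌊κ r n⌋`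
once `M r ≤ 1/8` and `κ n ≥ 2(M+5)`. [folklore] -/
theorem scales_sep_one {M : ℕ} {κ r : ℝ} {n : ℕ} (hκ : 0 ≤ κ) (hr : 0 ≤ r) (hMr : (M : ℝ) * r ≤ 1 / 8)
    (hn : 2 * ((M : ℝ) + 5) ≤ κ * n) : M * (⌊κ * r * n⌋₊ + 1) + 4 ≤ ⌊κ * n⌋₊ := by
  have hs : κ * n - 1 ≤ (⌊κ * n⌋₊ : ℝ) := by
    have := Nat.lt_floor_add_one (κ * n); linarith
  have hs' : (⌊κ * r * n⌋₊ : ℝ) ≤ κ * r * n := Nat.floor_le (by positivity)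
  have h1 : (M : ℝ) * ⌊κ * r * n⌋₊ ≤ κ * n / 8 :=
    calc (M : ℝ) * ⌊κ * r * n⌋₊ ≤ M * (κ * r * n) := mul_le_mul_of_nonneg_left hs' (Nat.cast_nonneg M)
      _ = κ * n * (M * r) := by ring
      _ ≤ κ * n * (1 / 8) := mul_le_mul_of_nonneg_left hMr (by positivity)
      _ = κ * n / 8 := by ring
  have : (M : ℝ) * (⌊κ * r * n⌋₊ + 1) + 4 ≤ ⌊κ * n⌋₊ := by
    have e : (M : ℝ) * (⌊κ * r * n⌋₊ + 1) + 4 = M * ⌊κ * r * n⌋₊ + M + 4 := by ring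
    rw [e]
    linarith
  exact_mod_cast this

/-- Scale separation, second form: `(2 M (s' + 1) + 2) K + 1 ≤ s` once `M K r ≤ 1/8` and
`κ n ≥ 4(MK + K + 1)`. [folklore] -/
theorem scales_sep_two {M K : ℕ} {κ r : ℝ} {n : ℕ} (hκ : 0 ≤ κ) (hr : 0 ≤ r)
    (hMKr : (M : ℝ) * K * r ≤ 1 / 8) (hn : 4 * ((M : ℝ) * K + K + 1) ≤ κ * n) :
    (2 * (M * (⌊κ * r * n⌋₊ + 1)) + 2) * K + 1 ≤ ⌊κ * n⌋₊ := by
  have hs : κ * n - 1 ≤ (⌊κ * n⌋₊ : ℝ) := by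
    have := Nat.lt_floor_add_one (κ * n); linarith
  have hs' : (⌊κ * r * n⌋₊ : ℝ) ≤ κ * r * n := Nat.floor_le (by positivity)
  have h1 : (M : ℝ) * K * ⌊κ * r * n⌋₊ ≤ κ * n / 8 :=
    calc (M : ℝ) * K * ⌊κ * r * n⌋₊ ≤ M * K * (κ * r * n) :=
          mul_le_mul_of_nonneg_left hs' (by positivity)
      _ = κ * n * (M * K * r) := by ring
      _ ≤ κ * n * (1 / 8) := mul_le_mul_of_nonneg_left hMKr (by positivity)
      _ = κ * n / 8 := by ring
  have : (2 * ((M : ℝ) * (⌊κ * r * n⌋₊ + 1)) + 2) * K + 1 ≤ ⌊κ * n⌋₊ := by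
    have e : (2 * ((M : ℝ) * (⌊κ * r * n⌋₊ + 1)) + 2) * K + 1 =
        2 * (M * K * ⌊κ * r * n⌋₊) + 2 * (M * K) + 2 * K + 1 := by ring
    rw [e]
    linarith
  exact_mod_cast this

/-- **The level cost at fixed `n`.**  With `s = ⌊κ n⌋`, `s' = ⌊κ r n⌋`, `D = M (s'+1)`,
`G = D + 1`, `m = 2D + 2`, `n' = ⌊(s−1)/K⌋`: for `M κ r n ≥ M + 1` and `κ n ≥ 2(K+1)`, the number
of grid windows meeting a zone of length `≤ Λ n` is `≤ Λ/(Mκr) + 2` and `m/n' ≤ 8 M K r`, whence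
`2 · #windows · C (m/n')^{1+α} ≤ 2 (Λ/(Mκr) + 2) C (8MKr)^{1+α}`. [folklore] -/
theorem level_cost_le {C α : ℝ} (hC : 0 ≤ C) (hα : 0 < α) {K M : ℕ} (hK : 1 ≤ K) (hM : 1 ≤ M)
    {Λ κ r : ℝ} (hΛ : 0 < Λ) (hκ : 0 < κ) (hr : 0 < r) {n : ℕ}
    (h3 : (M : ℝ) + 1 ≤ M * κ * r * n) (h4 : 2 * ((K : ℝ) + 1) ≤ κ * n) {z₀ z₁ : ℤ}
    (hz : (z₁ : ℝ) - z₀ ≤ Λ * n) :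
    2 * (((Finset.Icc (z₀ / (((M * (⌊κ * r * n⌋₊ + 1) : ℕ) : ℤ) + 1))
            (z₁ / (((M * (⌊κ * r * n⌋₊ + 1) : ℕ) : ℤ) + 1))).card : ℝ) *
          (C * ((((2 * (M * (⌊κ * r * n⌋₊ + 1)) + 2 : ℕ) : ℝ) /
            (((⌊κ * n⌋₊ - 1) / K : ℕ) : ℝ)) ^ (1 + α)))) ≤
      2 * ((Λ / (M * κ * r) + 2) * (C * ((8 * M * K * r) * (8 * M * K * r) ^ α))) := by
  set s : ℕ := ⌊κ * n⌋₊ with hs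
  set s' : ℕ := ⌊κ * r * n⌋₊ with hs'
  have hx0 : (0 : ℝ) < 8 * M * K * r := by positivity
  have hn0 : (0 : ℝ) ≤ n := Nat.cast_nonneg n
  have hs_lb : κ * n - 1 ≤ (s : ℝ) := by
    have := Nat.lt_floor_add_one (κ * n); rw [← hs] at this; linarith
  have hs'_ub : (s' : ℝ) ≤ κ * r * n := Nat.floor_le (by positivity)
  have hs'_lb : κ * r * n < (s' : ℝ) + 1 := by
    have := Nat.lt_floor_add_one (κ * r * n); rw [← hs'] at this; exact_mod_cast this
  -- the grid size and the number of windows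
  have hG : (0 : ℤ) < ((M * (s' + 1) : ℕ) : ℤ) + 1 := by positivity
  have hGr : (M : ℝ) * κ * r * n ≤ ((((M * (s' + 1) : ℕ) : ℤ) + 1 : ℤ) : ℝ) := by
    have e : ((((M * (s' + 1) : ℕ) : ℤ) + 1 : ℤ) : ℝ) = (M : ℝ) * ((s' : ℝ) + 1) + 1 := by push_cast; ring
    rw [e]
    have : (M : ℝ) * (κ * r * n) ≤ M * ((s' : ℝ) + 1) := mul_le_mul_of_nonneg_left hs'_lb.le (by positivity)
    linarith
  have hGpos : (0 : ℝ) < ((((M * (s' + 1) : ℕ) : ℤ) + 1 : ℤ) : ℝ) := by exact_mod_cast hG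
  have hcard := card_Icc_ediv_le (z₀ := z₀) (z₁ := z₁) hG
  have hmax : max ((z₁ : ℝ) - z₀) 0 ≤ Λ * n := max_le hz (by positivity)
  have hcard' : ((Finset.Icc (z₀ / (((M * (s' + 1) : ℕ) : ℤ) + 1))
      (z₁ / (((M * (s' + 1) : ℕ) : ℤ) + 1))).card : ℝ) ≤ Λ / (M * κ * r) + 2 := by
    refine le_trans hcard ?_
    have : max ((z₁ : ℝ) - z₀) 0 / ((((M * (s' + 1) : ℕ) : ℤ) + 1 : ℤ) : ℝ) ≤ Λ / (M * κ * r) := by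
      rw [div_le_div_iff₀ hGpos (by positivity)]
      calc max ((z₁ : ℝ) - z₀) 0 * (M * κ * r) ≤ Λ * n * (M * κ * r) :=
            mul_le_mul_of_nonneg_right hmax (by positivity)
        _ = Λ * (M * κ * r * n) := by ring
        _ ≤ Λ * ((((M * (s' + 1) : ℕ) : ℤ) + 1 : ℤ) : ℝ) := mul_le_mul_of_nonneg_left hGr hΛ.le
    linarith
  -- the window size over the scale
  have hm : (((2 * (M * (s' + 1)) + 2 : ℕ) : ℝ)) ≤ 4 * M * κ * r * n := by
    have e : (((2 * (M * (s' + 1)) + 2 : ℕ) : ℝ)) = 2 * (M * (s' : ℝ)) + 2 * M + 2 := by push_cast; ring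
    rw [e]
    have : (M : ℝ) * s' ≤ M * (κ * r * n) := mul_le_mul_of_nonneg_left hs'_ub (by positivity)
    linarith
  have hdiv : K * ((s - 1) / K) + K ≥ s := by
    have := Nat.div_add_mod (s - 1) K
    have := Nat.mod_lt (s - 1) (by omega : 0 < K)
    omega
  have hn' : κ * n / (2 * K) ≤ (((s - 1) / K : ℕ) : ℝ) := by
    rw [div_le_iff₀ (by positivity)]
    have : ((s : ℕ) : ℝ) ≤ K * (((s - 1) / K : ℕ) : ℝ) + K := by exact_mod_cast hdiv
    linarith
  have hκn : (0 : ℝ) < κ * n := lt_of_lt_of_le (by positivity) h4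
  have hn'pos : (0 : ℝ) < (((s - 1) / K : ℕ) : ℝ) := lt_of_lt_of_le (div_pos hκn (by positivity)) hn'
  have hratio : (((2 * (M * (s' + 1)) + 2 : ℕ) : ℝ)) / (((s - 1) / K : ℕ) : ℝ) ≤ 8 * M * K * r := by
    rw [div_le_iff₀ hn'pos]
    calc (((2 * (M * (s' + 1)) + 2 : ℕ) : ℝ)) ≤ 4 * M * κ * r * n := hm
      _ = 8 * M * K * r * (κ * n / (2 * K)) := by field_simp; ring
      _ ≤ 8 * M * K * r * (((s - 1) / K : ℕ) : ℝ) := mul_le_mul_of_nonneg_left hn' hx0.le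
  have hpow : ((((2 * (M * (s' + 1)) + 2 : ℕ) : ℝ)) / (((s - 1) / K : ℕ) : ℝ)) ^ (1 + α) ≤
      (8 * M * K * r) * (8 * M * K * r) ^ α := by
    have := Real.rpow_le_rpow (by positivity) hratio (by positivity : (0 : ℝ) ≤ 1 + α)
    rw [Real.rpow_add hx0, Real.rpow_one] at this
    exact this
  gcongr

/-- **Level by level choice of the scale ratio.**  For every current scale `κ > 0` there is a
ratio `r ∈ (0,1]` such that, eventually in `n`, the scales `s = ⌊κ n⌋`, `s' = ⌊κ r n⌋` are separated
(`scales_sep_one`, `scales_sep_two`) and the level cost is `≤ η` (`level_cost_le` and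
`(8MKr)^{α} → 0` as `r → 0`). [folklore] -/
theorem level_eventually {C α : ℝ} (hC : 0 ≤ C) (hα : 0 < α) {K M : ℕ} (hK : 1 ≤ K) (hM : 1 ≤ M)
    {Λ η : ℝ} (hΛ : 0 < Λ) (hη : 0 < η) (κ : ℝ) :
    ∃ r : ℝ, 0 < κ → (0 < r ∧ r ≤ 1 ∧ ∀ᶠ n : ℕ in atTop,
      M * (⌊κ * r * n⌋₊ + 1) + 4 ≤ ⌊κ * n⌋₊ ∧
      (2 * (M * (⌊κ * r * n⌋₊ + 1)) + 2) * K + 1 ≤ ⌊κ * n⌋₊ ∧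
      ∀ z₀ z₁ : ℤ, (z₁ : ℝ) - z₀ ≤ Λ * n →
        2 * (((Finset.Icc (z₀ / (((M * (⌊κ * r * n⌋₊ + 1) : ℕ) : ℤ) + 1))
            (z₁ / (((M * (⌊κ * r * n⌋₊ + 1) : ℕ) : ℤ) + 1))).card : ℝ) *
          (C * ((((2 * (M * (⌊κ * r * n⌋₊ + 1)) + 2 : ℕ) : ℝ) /
            (((⌊κ * n⌋₊ - 1) / K : ℕ) : ℝ)) ^ (1 + α)))) ≤ η) := by
  by_cases hκ : 0 < κ
  swap; · exact ⟨1, fun h => absurd h hκ⟩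
  have hMr : (1 : ℝ) ≤ M := by exact_mod_cast hM
  have hKr : (1 : ℝ) ≤ K := by exact_mod_cast hK
  -- the limit r → 0⁺ of the level cost
  set A : ℝ := 16 * C * Λ * K / κ with hA
  set B : ℝ := 4 * C with hB
  have hcont : Continuous fun r : ℝ =>
      A * (8 * M * K * r) ^ α + B * (8 * M * K * r) * (8 * M * K * r) ^ α := by
    have h1 : Continuous fun r : ℝ => (8 * M * K * r : ℝ) ^ α :=
      (Real.continuous_rpow_const hα.le).comp (continuous_const.mul continuous_id)
    exact (continuous_const.mul h1).add
      ((continuous_const.mul (continuous_const.mul continuous_id)).mul h1)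
  have hlim : Tendsto (fun r : ℝ =>
      A * (8 * M * K * r) ^ α + B * (8 * M * K * r) * (8 * M * K * r) ^ α) (𝓝 0) (𝓝 0) := by
    have := hcont.tendsto 0
    simpa [Real.zero_rpow hα.ne'] using this
  have ev1 : ∀ᶠ r : ℝ in 𝓝[>] 0,
      A * (8 * M * K * r) ^ α + B * (8 * M * K * r) * (8 * M * K * r) ^ α < η :=
    (hlim.eventually (gt_mem_nhds hη)).filter_mono nhdsWithin_le_nhds
  have ev2 : ∀ᶠ r : ℝ in 𝓝[>] 0, r < 1 / (8 * M * K) :=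
    (gt_mem_nhds (by positivity)).filter_mono nhdsWithin_le_nhds
  have ev3 : ∀ᶠ r : ℝ in 𝓝[>] 0, r ∈ Set.Ioi (0 : ℝ) := eventually_mem_nhdsWithin
  obtain ⟨r, hr1, hr2, hr3⟩ := (ev1.and (ev2.and ev3)).exists
  have hr0 : 0 < r := hr3
  have hMKr : (M : ℝ) * K * r ≤ 1 / 8 := by
    have h8 : (0 : ℝ) < 8 * M * K := by positivity
    have := (lt_div_iff₀ h8).1 hr2
    linarith
  have hMr8 : (M : ℝ) * r ≤ 1 / 8 := by
    have : (M : ℝ) * r ≤ M * r * K := le_mul_of_one_le_right (by positivity) hKr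
    linarith
  have hr_le : r ≤ 1 := by
    have : r ≤ M * r := le_mul_of_one_le_left hr0.le hMr
    linarith
  have hx0 : (0 : ℝ) < 8 * M * K * r := by positivity
  refine ⟨r, fun _ => ⟨hr0, hr_le, ?_⟩⟩
  have T : ∀ c : ℝ, ∀ᶠ n : ℕ in atTop, c ≤ (n : ℝ) := fun c =>
    tendsto_natCast_atTop_atTop.eventually_ge_atTop c
  filter_upwards [T (2 * (M + 5) / κ), T (4 * (M * K + K + 1) / κ), T ((M + 1) / (M * κ * r)),
    T (2 * (K + 1) / κ)] with n h1 h2 h3 h4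
  have h1' : 2 * ((M : ℝ) + 5) ≤ κ * n := by
    have := (div_le_iff₀ hκ).1 h1; linarith
  have h2' : 4 * ((M : ℝ) * K + K + 1) ≤ κ * n := by
    have := (div_le_iff₀ hκ).1 h2; linarith
  have h3' : (M : ℝ) + 1 ≤ M * κ * r * n := by
    have := (div_le_iff₀ (by positivity : (0 : ℝ) < M * κ * r)).1 h3; linarith
  have h4' : 2 * ((K : ℝ) + 1) ≤ κ * n := by
    have := (div_le_iff₀ hκ).1 h4; linarith
  refine ⟨scales_sep_one hκ.le hr0.le hMr8 h1', scales_sep_two hκ.le hr0.le hMKr h2',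
    fun z₀ z₁ hz => ?_⟩
  have halg : 2 * ((Λ / (M * κ * r) + 2) * (C * ((8 * M * K * r) * (8 * M * K * r) ^ α))) =
      A * (8 * M * K * r) ^ α + B * (8 * M * K * r) * (8 * M * K * r) ^ α := by
    rw [hA, hB]
    field_simp
    ring
  exact le_trans (level_cost_le hC hα hK hM hΛ hκ hr0 h3' h4' hz) (halg ▸ hr1.le)


/-! ### The bulk event is small -/

/-- **Smallness of the bulk few-touches event**, `M ≥ 1`. See `bulk_small`.
[cite: LawlerSchrammWernerEJP2002, Appendix A] -/
theorem bulk_small_pos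
    (hiso : ∀ {ω : BondConfig (Site 2)}, ω ⊆ (zdGraph 2).edgeSet → ∀ (t t' : ℤ) (s : ℕ), t ≤ t' → t' - t + 4 ≤ s → (∃ v : Site 2, (t' - t + 2 * s ≤ |v 0 - t| ∨ t' - t + 2 * s ≤ v 1) ∧ ω ∈ openConnIn halfPlane (bpt t) v) → (∀ u : ℤ, (t - s ≤ u ∧ u < t) ∨ (t' < u ∧ u ≤ t' + s) → ω ∉ openConnIn halfPlane (bpt t) (bpt u)) → leg t ∈ ω → ω ∈ Z2HalfPlane.threeArm (t - 1) (t' - t + 2).toNat (s - 1))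
    {M : ℕ} (hM : 1 ≤ M) {Λ δ ε : ℝ} (hΛ : 0 < Λ) (hδ : 0 < δ) (hε : 0 < ε) :
    ∀ᶠ n : ℕ in atTop, ∀ (z₀ z₁ : ℤ) (F : Set (Site 2)), (z₁ : ℝ) - z₀ ≤ Λ * n →
      (∀ f ∈ F, ∀ t : ℤ, z₀ ≤ t → t ≤ z₁ → 3 * ⌊δ * n⌋ ≤ |f 0 - t| ∨ 3 * ⌊δ * n⌋ ≤ f 1) →
      μ.real {ω : BondConfig (Site 2) | ∃ t : ℤ, z₀ + ⌊δ * n⌋ ≤ t ∧ t ≤ z₁ - ⌊δ * n⌋ ∧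
        ω ∈ openCrossing halfPlane {bpt t} F ∧
        (∀ u : ℤ, z₀ ≤ u → u ≤ z₁ → ω ∈ openConnIn halfPlane (bpt t) (bpt u) →
          z₀ + ⌊δ * n⌋ ≤ u ∧ u ≤ z₁ - ⌊δ * n⌋) ∧
        {u : ℤ | z₀ ≤ u ∧ u ≤ z₁ ∧ ω ∈ openConnIn halfPlane (bpt t) (bpt u)}.ncard ≤ M} ≤ ε := by
  obtain ⟨C, α, hC, hα, K, hK, h3arm⟩ := Z2HalfPlane.real_threeArm_le
  have hη : 0 < ε / (M + 1) := by positivity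
  have hlev := fun κ => level_eventually hC.le hα hK hM hΛ hη κ
  choose r hr using hlev
  -- the scales κ₀ = δ/2, κ_{j+1} = κ_j r(κ_j)
  set κs : ℕ → ℝ := fun j => Nat.rec (δ / 2) (fun _ p => p * r p) j with hκs
  have hκ0 : κs 0 = δ / 2 := rfl
  have hκsucc : ∀ j, κs (j + 1) = κs j * r (κs j) := fun j => rfl
  have hκpos : ∀ j, 0 < κs j := by
    intro j
    induction j with
    | zero => rw [hκ0]; positivity
    | succ j ih => rw [hκsucc]; exact mul_pos ih (hr (κs j) ih).1
  have hκanti : ∀ j, κs (j + 1) ≤ κs j := fun j => by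
    rw [hκsucc]; exact mul_le_of_le_one_right (hκpos j).le (hr (κs j) (hκpos j)).2.1
  have hev : ∀ᶠ n : ℕ in atTop, ∀ j ∈ Finset.range (M + 1),
      M * (⌊κs j * r (κs j) * n⌋₊ + 1) + 4 ≤ ⌊κs j * n⌋₊ ∧
      (2 * (M * (⌊κs j * r (κs j) * n⌋₊ + 1)) + 2) * K + 1 ≤ ⌊κs j * n⌋₊ ∧
      ∀ z₀ z₁ : ℤ, (z₁ : ℝ) - z₀ ≤ Λ * n →
        2 * (((Finset.Icc (z₀ / (((M * (⌊κs j * r (κs j) * n⌋₊ + 1) : ℕ) : ℤ) + 1))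
            (z₁ / (((M * (⌊κs j * r (κs j) * n⌋₊ + 1) : ℕ) : ℤ) + 1))).card : ℝ) *
          (C * ((((2 * (M * (⌊κs j * r (κs j) * n⌋₊ + 1)) + 2 : ℕ) : ℝ) /
            (((⌊κs j * n⌋₊ - 1) / K : ℕ) : ℝ)) ^ (1 + α)))) ≤ ε / (M + 1) :=
    (Filter.eventually_all_finset _).2 fun j _ => (hr (κs j) (hκpos j)).2.2
  filter_upwards [hev] with n hn z₀ z₁ F hz hF
  set s : ℕ → ℕ := fun j => ⌊κs j * n⌋₊ with hsdef
  have hs_j : ∀ j, s j = ⌊κs j * n⌋₊ := fun j => rfl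
  have hs_succ : ∀ j, s (j + 1) = ⌊κs j * r (κs j) * n⌋₊ := fun j => by
    show ⌊κs (j + 1) * (n : ℝ)⌋₊ = _; rw [hκsucc]
  have hs_anti : ∀ j, s (j + 1) ≤ s j := fun j =>
    Nat.floor_le_floor (mul_le_mul_of_nonneg_right (hκanti j) (Nat.cast_nonneg n))
  have h1 : ∀ j, j ≤ M → M * (s (j + 1) + 1) + 4 ≤ s j := fun j hj => by
    rw [hs_succ, hs_j]; exact (hn j (Finset.mem_range.2 (by omega))).1
  have hℓ : (s 0 : ℤ) ≤ ⌊δ * n⌋ := by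
    rw [Int.le_floor, hs_j, hκ0]
    push_cast
    have := Nat.floor_le (a := δ / 2 * n) (by positivity)
    have hn0 : (0 : ℝ) ≤ n := Nat.cast_nonneg n
    nlinarith
  refine le_trans (measureReal_bulk_le hiso M s hs_anti h1 hℓ F hF) ?_
  have hlevel : ∀ j ∈ Finset.range (M + 1),
      2 * ∑ g ∈ Finset.Icc (z₀ / (((M * (s (j + 1) + 1) : ℕ) : ℤ) + 1))
          (z₁ / (((M * (s (j + 1) + 1) : ℕ) : ℤ) + 1)),
        μ.real (threeArm ((((M * (s (j + 1) + 1) : ℕ) : ℤ) + 1) * g - 1) (2 * (M * (s (j + 1) + 1)) + 2)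
          (s j - 1)) ≤ ε / (M + 1) := by
    intro j hj
    obtain ⟨-, hc2, hc3⟩ := hn j hj
    have hc3' := hc3 z₀ z₁ hz
    rw [← hs_succ, ← hs_j] at hc2 hc3'
    have hKpos : 0 < K := by omega
    have hm : 2 * (M * (s (j + 1) + 1)) + 2 ≤ (s j - 1) / K := by
      rw [Nat.le_div_iff_mul_le hKpos]; omega
    have hR : K * ((s j - 1) / K) ≤ s j - 1 := Nat.mul_div_le _ _
    have hw : ∀ g : ℤ, μ.real (threeArm ((((M * (s (j + 1) + 1) : ℕ) : ℤ) + 1) * g - 1)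
        (2 * (M * (s (j + 1) + 1)) + 2) (s j - 1)) ≤
        C * ((((2 * (M * (s (j + 1) + 1)) + 2 : ℕ) : ℝ)) / (((s j - 1) / K : ℕ) : ℝ)) ^ (1 + α) :=
      fun g => h3arm _ _ _ _ (by omega) hm hR
    calc 2 * ∑ g ∈ Finset.Icc (z₀ / (((M * (s (j + 1) + 1) : ℕ) : ℤ) + 1))
            (z₁ / (((M * (s (j + 1) + 1) : ℕ) : ℤ) + 1)),
          μ.real (threeArm ((((M * (s (j + 1) + 1) : ℕ) : ℤ) + 1) * g - 1) (2 * (M * (s (j + 1) + 1)) + 2)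
            (s j - 1))
        ≤ 2 * ∑ g ∈ Finset.Icc (z₀ / (((M * (s (j + 1) + 1) : ℕ) : ℤ) + 1))
            (z₁ / (((M * (s (j + 1) + 1) : ℕ) : ℤ) + 1)),
          C * ((((2 * (M * (s (j + 1) + 1)) + 2 : ℕ) : ℝ)) / (((s j - 1) / K : ℕ) : ℝ)) ^ (1 + α) :=
          mul_le_mul_of_nonneg_left (Finset.sum_le_sum fun g _ => hw g) (by norm_num)
      _ = 2 * (((Finset.Icc (z₀ / (((M * (s (j + 1) + 1) : ℕ) : ℤ) + 1))
            (z₁ / (((M * (s (j + 1) + 1) : ℕ) : ℤ) + 1))).card : ℝ) *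
          (C * ((((2 * (M * (s (j + 1) + 1)) + 2 : ℕ) : ℝ)) / (((s j - 1) / K : ℕ) : ℝ)) ^ (1 + α))) := by
          rw [Finset.sum_const, nsmul_eq_mul]
      _ ≤ ε / (M + 1) := hc3'
  calc ∑ j ∈ Finset.range (M + 1), 2 * ∑ g ∈ Finset.Icc (z₀ / (((M * (s (j + 1) + 1) : ℕ) : ℤ) + 1))
          (z₁ / (((M * (s (j + 1) + 1) : ℕ) : ℤ) + 1)),
        μ.real (threeArm ((((M * (s (j + 1) + 1) : ℕ) : ℤ) + 1) * g - 1) (2 * (M * (s (j + 1) + 1)) + 2)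
          (s j - 1))
      ≤ ∑ j ∈ Finset.range (M + 1), ε / (M + 1) := Finset.sum_le_sum hlevel
    _ = ε := by
      rw [Finset.sum_const, Finset.card_range, nsmul_eq_mul]
      push_cast
      field_simp

/-- **Smallness of the bulk few-touches event, given the isolated-block lemma** (registered stub
`bulk_small_of`; `bulk_small` itself follows by feeding `isoBlock_threeArm`): for every `M`,
zone-length ratio `Λ`, end-zone ratio `δ` and `ε > 0`, eventually in `n`, for every zone `[z₀, z₁]`
of length `≤ Λ n` and every target `F` at sup-distance `≥ 3⌊δn⌋` from the zone, the probability
that some `(t,0)`, `t ∈ [z₀ + ⌊δn⌋, z₁ − ⌊δn⌋]`, is joined to `F` inside `H` while its `H`-cluster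
has at most `M` boundary sites in the zone, all in `[z₀ + ⌊δn⌋, z₁ − ⌊δn⌋]`, is at most `ε`
(`M = 0` is reduced to `M = 1` by monotonicity). [cite: LawlerSchrammWernerEJP2002, Appendix A] -/
theorem bulk_small_of : (∀ {ω : BondConfig (Site 2)}, ω ⊆ (zdGraph 2).edgeSet → ∀ (t t' : ℤ) (s : ℕ), t ≤ t' → t' - t + 4 ≤ s → (∃ v : Site 2, (t' - t + 2 * s ≤ |v 0 - t| ∨ t' - t + 2 * s ≤ v 1) ∧ ω ∈ openConnIn halfPlane (bpt t) v) → (∀ u : ℤ, (t - s ≤ u ∧ u < t) ∨ (t' < u ∧ u ≤ t' + s) → ω ∉ openConnIn halfPlane (bpt t) (bpt u)) → leg t ∈ ω → ω ∈ Z2HalfPlane.threeArm (t - 1) (t' - t + 2).toNat (s - 1)) → ∀ (M : ℕ) {Λ δ ε : ℝ}, 0 < Λ → 0 < δ → 0 < ε → ∀ᶠ n : ℕ in atTop, ∀ (z₀ z₁ : ℤ) (F : Set (Site 2)), (z₁ : ℝ) - z₀ ≤ Λ * n → (∀ f ∈ F, ∀ t : ℤ, z₀ ≤ t → t ≤ z₁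 → 3 * ⌊δ * n⌋ ≤ |f 0 - t| ∨ 3 * ⌊δ * n⌋ ≤ f 1) → μ.real {ω : BondConfig (Site 2) | ∃ t : ℤ, z₀ + ⌊δ * n⌋ ≤ t ∧ t ≤ z₁ - ⌊δ * n⌋ ∧ ω ∈ openCrossing halfPlane {bpt t} F ∧ (∀ u : ℤ, z₀ ≤ u → u ≤ z₁ → ω ∈ openConnIn halfPlane (bpt t) (bpt u) → z₀ + ⌊δ * n⌋ ≤ u ∧ u ≤ z₁ - ⌊δ * n⌋) ∧ {u : ℤ | z₀ ≤ u ∧ u ≤ z₁ ∧ ω ∈ openConnIn halfPlane (bpt t) (bpt u)}.ncard ≤ M} ≤ ε := by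
  intro hiso M Λ δ ε hΛ hδ hε
  filter_upwards [bulk_small_pos hiso (M := M + 1) (by omega) hΛ hδ hε] with n hn z₀ z₁ F hz hF
  refine le_trans (measureReal_mono ?_ (measure_ne_top _ _)) (hn z₀ z₁ F hz hF)
  rintro ω ⟨t, h1, h2, h3, h4, h5⟩
  exact ⟨t, h1, h2, h3, h4, by omega⟩

end Summit.CriticalPhenomena.CardyFormulaZ2.Cruxes.HalfPlaneMarkDensityLaw.SketchLine.SelfDual
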